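import Summits.HodgeConjecture.HodgeConjecture.Theorems.MarkmanPartnerTransportPicardThreeK3SquaresPicardTwelveSqrtTwoField
import Literature.AlgebraicGeometry.Surfaces.GeometricGenusOneAssociatedK3Surface

/-!
# Route MarkmanPartnerTransport · crux `PicardThreeK3Squares` (stmt-HodgeConjecture-19652) —
# Picard rank `≥ 12`: the `√2`-sector clause `End_Hdg(T(S)) ⊆ ℚ + ℚψ` is AUTOMATIC (or `S` has CM)

For a marked projective K3 surface `(S, η, p, x)` with `ρ(S) ≥ 12` and a rational, Hodge-type-preserving
endomorphism `ψ` of `H²(S(ℂ); ℂ)` with `ψ² = 2` and multiplier `2` on `T(S)`: either the full `√2`-sector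
data of `SymplecticLocus.hodgeConjectureFor_square_of_isNikulinInvolution` hold for `ψ` (in particular
every rational Hodge endomorphism of `H²(S)` killing `N¹` with image `⊥ N¹` is `a + bψ` on `T(S)`), or `S`
has complex multiplication. Marked picture as in `RealMultiplicationRanks` / `HighPicard` (`N_ℚ`,
`T = N_ℚ^⊥`, the transcendental Hodge structure `hodgeT`, Zarhin's field `E`, `anchorExistence_cmFloor_exists_ratEnd`,
`restrict_mem_endAlg`); the totally real case is `exists_eq_algebraMap_add_smul_of_mul_self_eq_two`
(`dim T ≤ 10`), the CM case is Zarhin's adjoint theorem as in `RealMultiplicationRanks`.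

* `sqrtSector_or_hasComplexMultiplication` — the dichotomy.

No definition, no named fact, no sorry. Prover seat hodge-nonav-19652-p1 (gen 3),
`--supports stmt-HodgeConjecture-19652`.

References: Yu. G. Zarhin, J. reine angew. Math. 341 (1983), Thm. 1.5.1, 1.6; B. van Geemen, Michigan
Math. J. 56 (2008), Lemma 3.2; M. Varesco, Math. Z. 305 (2023), Rem. 2.10; D. Huybrechts, *Lectures on K3
Surfaces*, Ch. 3 Lemma 3.3.1, Thm. 3.3.7.
-/

set_option linter.dupNamespace false

noncomputable section

namespace Summit.HodgeConjecture.HodgeConjecture.Theorems.MarkmanPartnerTransport.NikulinIsogeny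

open scoped TensorProduct IntermediateField
open Module CategoryTheory MonoidalCategory
open Literature.AlgebraicGeometry Literature.AlgebraicGeometry.Motives Literature.AlgebraicGeometry.HodgeTheory
open Literature.AlgebraicGeometry.Motives.HodgeStructure
open Literature.AlgebraicGeometry.Surfaces
open Literature.AlgebraicTopology.SingularHomology
open Summit.HodgeConjecture.HodgeConjecture.Theorems
open Summit.HodgeConjecture.HodgeConjecture.Theorems.NikulinTwinTransport
open Summit.HodgeConjecture.HodgeConjecture.Theorems.AnchorExistenceCMFloor
open Summit.HodgeConjecture.HodgeConjecture.Theorems.MarkmanPartnerTransport.RealMultiplicationRanks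

variable {S : SchemeOver ℂ}

/-- `MarkedK3[S, η, p, x]`: VERBATIM the `let MarkedK3 := …` binder of the route declaration
`PicardThreeK3Squares`. Local notation only. -/
local notation3 (prettyPrint := false) "MarkedK3[" S ", " η ", " p ", " x "]" =>
  (p ≠ 0 ∧ (IsIntegralClass p ∧
    (∀ q : complexBetti S (2 * 2), IsIntegralClass q → ∃ n : ℤ, q = n • p) ∧
    (∀ c : complexBetti S (2 * 1), IsIntegralClass c ↔ ∃ v : K3Index → ℤ, η c = fun i => (v i : ℂ)) ∧
    (∀ a b : complexBetti S (2 * 1),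
      cupProduct (rfl : 2 * 1 + 2 * 1 = 2 * 2) a b = k3Form (η a) (η b) • p) ∧
    IsOfHodgeType 2 S (2 * 1) 2 0 (LinearEquiv.symm η x) ∧
    (∀ τ : complexBetti S (2 * 1), IsOfHodgeType 2 S (2 * 1) 2 0 τ →
      ∃ t : ℂ, τ = t • LinearEquiv.symm η x)) ∧
    (k3Form x x = 0 ∧ 0 < (k3Form (star x) x).re ∧
      ∃ u : K3Index → ℤ, k3Form (fun i => (u i : ℂ)) x = 0 ∧ 0 < ∑ i, ∑ j, u i * k3Gram i j * u j))

/-- `SqrtSector[S, ψ]`: the `√2`-sector data of `SymplecticLocus.hodgeConjectureFor_square_of_isNikulinInvolution`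
(as in `…PicardElevenSqrtTwo`). Local notation only. -/
local notation3 (prettyPrint := false) "SqrtSector[" S ", " ψ "]" =>
  (Set.MapsTo ψ (transcendentalSubspace S) (transcendentalSubspace S) ∧
    (∀ x ∈ transcendentalSubspace S, IsRationalClass x → IsRationalClass (ψ x)) ∧
    (∀ (i j : ℕ), ∀ x ∈ transcendentalSubspace S,
      IsOfHodgeType 2 S (2 * 1) i j x → IsOfHodgeType 2 S (2 * 1) i j (ψ x)) ∧
    (∀ x ∈ transcendentalSubspace S, ψ (ψ x) = (2 : ℂ) • x) ∧
    (∀ x ∈ transcendentalSubspace S, ∀ y ∈ transcendentalSubspace S,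
      cupProduct (rfl : 2 * 1 + 2 * 1 = 2 * 2) (ψ x) (ψ y) =
        (2 : ℂ) • cupProduct (rfl : 2 * 1 + 2 * 1 = 2 * 2) x y) ∧
    (∀ (f : complexBetti S (2 * 1) →ₗ[ℂ] complexBetti S (2 * 1)),
      (∀ y, IsRationalClass y → IsRationalClass (f y)) →
      (∀ (i j : ℕ) y, IsOfHodgeType 2 S (2 * 1) i j y → IsOfHodgeType 2 S (2 * 1) i j (f y)) →
      (∀ d ∈ algebraicClasses S 1, f d = 0) →
      (∀ y : complexBetti S (2 * 1), ∀ d ∈ algebraicClasses S 1,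
        cupProduct (rfl : 2 * 1 + 2 * 1 = 2 * 2) (f y) d = 0) →
      ∃ a b : ℚ, ∀ y : complexBetti S (2 * 1),
        (∀ d ∈ algebraicClasses S 1, cupProduct (rfl : 2 * 1 + 2 * 1 = 2 * 2) y d = 0) →
        f y = (a : ℂ) • y + (b : ℂ) • ψ y))


/-! ### The `√2`-sector clause is automatic at Picard rank `≥ 12` (or `S` has CM) -/

/-- **At Picard rank `≥ 12`, a `√2`-similitude of `T(S)` generates `End_Hdg(T(S))` unless `S` has
complex multiplication.** Let `(S, η, p, x)` be a marked projective K3 surface with `ρ(S) ≥ 12` and `ψ`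
a rational, Hodge-type-preserving endomorphism of `H²(S(ℂ); ℂ)` with `ψ² = 2` and multiplier `2` on
`T(S) = transcendentalSubspace S`. Then either the full `√2`-sector data hold for `ψ` (`ψ` preserves
`T(S)`, and every rational Hodge endomorphism of `H²(S)` killing `N¹` with image `⊥ N¹` is `a + bψ` on
`T(S)`), or `S` has complex multiplication. Proof: `E = End_Hdg(T(S)_ℚ)` (on the marked carrier
`hodgeT`) is a field (Zarhin); if an embedding of `E` is not real, Zarhin's adjoint theorem yields a
CM endomorphism (as in `RealMultiplicationRanks`); if `E` is totally real, `rk T = [E:ℚ]·m`, `m ≥ 3`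
(van Geemen) and `rk T ≤ 10` give `[E:ℚ] ≤ 3`, while `ψ|_T ∈ E` has minimal polynomial `X² − 2`, so
`[ℚ(ψ|_T):ℚ] = 2` divides `[E:ℚ]`, `E = ℚ(ψ|_T) = ℚ + ℚψ|_T`.
[cite: Zarhin1983HodgeGroupsK3, Thm. 1.5.1 and 1.6] [cite: Vangeemen2008, Lemma 3.2]
[cite: Varesco2023, Rem. 2.10] [cite: Huybrechts2016K3, Ch. 3 Lemma 3.3.1 and Thm. 3.3.7] -/
theorem sqrtSector_or_hasComplexMultiplication (hS : IsK3Surface S)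
    (η : complexBetti S (2 * 1) ≃ₗ[ℂ] (K3Index → ℂ)) (p : complexBetti S (2 * 2)) (x : K3Index → ℂ)
    (hM : MarkedK3[S, η, p, x]) (hρ : 12 ≤ Module.finrank ℂ ↥(algebraicClasses S 1))
    (ψ : complexBetti S (2 * 1) →ₗ[ℂ] complexBetti S (2 * 1))
    (hψrat : ∀ y, IsRationalClass y → IsRationalClass (ψ y))
    (hψtyp : ∀ (i j : ℕ) y, IsOfHodgeType 2 S (2 * 1) i j y → IsOfHodgeType 2 S (2 * 1) i j (ψ y))
    (hψsq : ∀ y ∈ transcendentalSubspace S, ψ (ψ y) = (2 : ℂ) • y)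
    (hψmul : ∀ y ∈ transcendentalSubspace S, ∀ z ∈ transcendentalSubspace S,
      cupProduct (rfl : 2 * 1 + 2 * 1 = 2 * 2) (ψ y) (ψ z) =
        (2 : ℂ) • cupProduct (rfl : 2 * 1 + 2 * 1 = 2 * 2) y z) :
    SqrtSector[S, ψ] ∨ HasComplexMultiplication S := by
  classical
  have h4 : 2 * 1 + 2 * 1 = 2 * 2 := rfl
  have hHT : Huybrechts_K3_hodgeTypes_H2 := Huybrechts_K3_hodgeTypes_H2_holds
  obtain ⟨hp₀, ⟨hp₀int, hp₀gen, hηint, hηcup, hx20, hx20'⟩, hxx, hxpos, hu⟩ := hM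
  set N := algebraicClasses S 1 with hNdef
  set σ := η.symm x with hσdef
  have hησ : η σ = x := by rw [hσdef, LinearEquiv.apply_symm_apply]
  have hxne : σ ≠ 0 := fun h0 => ne_zero_of_star_self_re_pos hxpos (by rw [← hησ, h0, map_zero])
  obtain ⟨h₁, -, h₃⟩ := hHT S hS σ hx20 hxne
  have hσbar : conjClass (ComplexPoints S) (2 * 1) σ = η.symm (star x) := conjClass_marking_symm η hηint x
  have hsmul0 : ∀ {c : ℂ}, c • p = 0 → c = 0 := fun h => by
    rcases smul_eq_zero.1 h with h | h
    · exact h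
    · exact absurd h hp₀
  have hL11 : ∀ c : complexBetti S (2 * 1), IsRationalClass c → IsOfHodgeType 2 S (2 * 1) 1 1 c → c ∈ N :=
    fun c hc h11 => lefschetzOneOne_rational_holds hS.1 c hc h11
  have hND : ∀ c ∈ N, IsRationalClass c →
      (∀ d ∈ N, cupProduct (rfl : 2 * 1 + 2 * 1 = 2 * 2) c d = 0) → c = 0 :=
    fun c hcN hc hperp => anchorExistence_cmFloor_divisorClass_eq_zero_of_hodgeIndex
      hodgeIndex_surface_holds lefschetzOneOne_rational_holds
      Grothendieck1969_supportedClasses_le_hodgeConiveau_holds hS hcN hc hperp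
  have hrat : ∀ c, IsRationalClass c ↔ ∃ w : K3Index → ℚ, η c = fun i => (w i : ℂ) :=
    isRationalClass_iff_of_marking hS η hηint
  -- the rational points of `N`
  let NQ : Submodule ℚ (K3Index → ℚ) :=
    { carrier := {u | η.symm (fun j => (u j : ℂ)) ∈ N}
      add_mem' := fun {u v} hu hv => by
        simp only [Set.mem_setOf_eq, ratCastΛ_add, map_add]
        exact N.add_mem hu hv
      zero_mem' := by
        simp only [Set.mem_setOf_eq, ratCastΛ_zero, map_zero]
        exact N.zero_mem
      smul_mem' := fun q u hu => by
        simp only [Set.mem_setOf_eq, ratCastΛ_smul, map_smul]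
        exact N.smul_mem _ hu }
  have memNQ : ∀ u, u ∈ NQ ↔ η.symm (fun j => (u j : ℂ)) ∈ N := fun u => Iff.rfl
  have h11_iff : ∀ v : K3Index → ℂ, IsOfHodgeType 2 S (2 * 1) 1 1 (η.symm v) ↔
      (k3Form v x = 0 ∧ k3Form v (star x) = 0) := by
    intro v
    rw [h₃ (η.symm v), hηcup, hηcup, LinearEquiv.apply_symm_apply, hησ, hσbar, LinearEquiv.apply_symm_apply]
    constructor
    · rintro ⟨ha, hb⟩
      exact ⟨hsmul0 ha, hsmul0 hb⟩
    · rintro ⟨ha, hb⟩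
      rw [ha, hb, zero_smul]
      exact ⟨rfl, rfl⟩
  have hN : ∀ u : K3Index → ℚ, u ∈ NQ ↔
      (k3Form (fun i => (u i : ℂ)) x = 0 ∧ k3Form (fun i => (u i : ℂ)) (star x) = 0) := by
    intro u
    rw [memNQ, ← h11_iff]
    constructor
    · intro hu
      exact isOfHodgeType_of_mem_algebraicClasses_of_isSmoothProjective hS.1 1 hu
    · intro hu
      exact hL11 _ ((hrat _).2 ⟨u, LinearEquiv.apply_symm_apply _ _⟩) hu
  have hspan := span_isRationalClass_eq_top_of_isSmoothProjective_holds.supportedClasses_eq_span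
    hS.1 (2 * 1) 1
  have horth : ∀ u ∈ k3FormRat.orthogonal NQ, ∀ d ∈ N, k3Form (fun j => (u j : ℂ)) (η d) = 0 := by
    intro u hu d hd
    rw [LinearMap.BilinForm.mem_orthogonal_iff] at hu
    have hd' : d ∈ Submodule.span ℂ {c : complexBetti S (2 * 1) |
        IsRationalClass c ∧ c ∈ supportedClasses S (2 * 1) 1} := by
      rw [← hspan]; exact hd
    clear hd
    induction hd' using Submodule.span_induction with
    | mem d hd =>
      obtain ⟨w, hw⟩ := (hrat d).1 hd.1
      have hwN : w ∈ NQ := by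
        rw [memNQ, ← hw, LinearEquiv.symm_apply_apply]
        exact hd.2
      rw [hw, k3Form_ratCast, k3FormRat_isSymm.eq, hu w hwN, Rat.cast_zero]
    | zero => rw [map_zero, k3Form_zero_right]
    | add c c' _ _ hc hc' => rw [map_add, k3Form_add_right, hc, hc', add_zero]
    | smul t c _ hc => rw [map_smul, k3Form_smul_right, hc, mul_zero]
  have hdisj : Disjoint NQ (k3FormRat.orthogonal NQ) := by
    rw [Submodule.disjoint_def]
    intro u huN huT
    have hc0 : η.symm (fun j => (u j : ℂ)) = 0 :=
      hND _ ((memNQ u).1 huN) ((hrat _).2 ⟨u, LinearEquiv.apply_symm_apply _ _⟩) fun d hd => by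
        rw [hηcup, LinearEquiv.apply_symm_apply, horth u huT d hd, zero_smul]
    apply ratCastΛ_injective
    rw [ratCastΛ_zero]
    exact η.symm.injective (hc0.trans (map_zero _).symm)
  have hc := isCompl_orthogonal hdisj
  set T := k3FormRat.orthogonal NQ with hTdef
  -- the transcendental Hodge structure, irreducible of K3 type, polarized; `E` is a field
  set H := hodgeT hN hdisj hxx hxpos with hH
  have hK3 : H.IsOfK3Type := isOfK3Type_hodgeT hN hdisj hxx hxpos
  have hirr : H.IsIrreducible := isIrreducible_hodgeT hN hdisj hxx hxpos
  set pol : H.Polarization := polT hN hdisj hxx hxpos hu with hpol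
  obtain ⟨hFld, ε, hεinj, hε⟩ := Zarhin1983_endAlg_isField_holds H hirr hK3
  -- `dim_ℚ T ≤ 10`
  have hdimN : Module.finrank ℂ ↥N ≤ Module.finrank ℚ ↥NQ := by
    let b := Module.finBasis ℚ NQ
    let c : Fin (Module.finrank ℚ ↥NQ) → complexBetti S (2 * 1) :=
      fun i => η.symm (fun j => (((b i : NQ) : K3Index → ℚ) j : ℂ))
    have hle : N ≤ Submodule.span ℂ (Set.range c) := by
      intro d hd
      have hd' : d ∈ Submodule.span ℂ {c : complexBetti S (2 * 1) |
          IsRationalClass c ∧ c ∈ supportedClasses S (2 * 1) 1} := by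
        rw [← hspan]; exact hd
      refine Submodule.span_le.2 ?_ hd'
      rintro d ⟨hdQ, hdN⟩
      obtain ⟨w, hw⟩ := (hrat d).1 hdQ
      have hwN : w ∈ NQ := by
        rw [memNQ, ← hw, LinearEquiv.symm_apply_apply]
        exact hdN
      have hd_eq : d = η.symm (fun j => (w j : ℂ)) := by rw [← hw, LinearEquiv.symm_apply_apply]
      have hw_eq : (w : K3Index → ℚ) = ∑ i, (b.repr ⟨w, hwN⟩ i) • ((b i : NQ) : K3Index → ℚ) := by
        have h := congrArg (fun t : NQ => (t : K3Index → ℚ)) (b.sum_repr ⟨w, hwN⟩).symm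
        simpa only [Submodule.coe_sum, Submodule.coe_smul] using h
      rw [SetLike.mem_coe, hd_eq, hw_eq, ratCastΛ_sum, map_sum]
      refine Submodule.sum_mem _ fun i _ => ?_
      rw [ratCastΛ_smul, map_smul]
      exact Submodule.smul_mem _ _ (Submodule.subset_span ⟨i, rfl⟩)
    haveI : Module.Finite ℂ ↥(Submodule.span ℂ (Set.range c)) :=
      Module.Finite.span_of_finite ℂ (Set.finite_range c)
    exact (Submodule.finrank_mono hle).trans ((finrank_range_le_card c).trans (by simp))
  have hdimT : Module.finrank ℚ ↥T ≤ 10 := by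
    rw [hTdef, LinearMap.BilinForm.finrank_orthogonal k3FormRat_nondegenerate, finrank_k3Rat]
    omega
  -- membership in `T(S)` through the marking
  have hTiff : ∀ y, y ∈ transcendentalSubspace S ↔ ∀ d ∈ N, cupProduct h4 y d = 0 :=
    fun y ↦ mem_transcendentalSubspace_iff_forall_algebraicClasses hS.1 y
  have hmemT_of_T : ∀ u ∈ T, η.symm (fun i => (u i : ℂ)) ∈ transcendentalSubspace S := by
    intro u hu
    rw [hTiff]
    intro d hd
    rw [hηcup, LinearEquiv.apply_symm_apply, horth u hu d hd, zero_smul]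
  have hspanT : ∀ y ∈ transcendentalSubspace S,
      η y ∈ Submodule.span ℂ (Set.range fun t : T => fun i => ((t : K3Index → ℚ) i : ℂ)) := by
    intro y hy
    have hzN : ∀ n ∈ NQ, k3Form (η y) (fun i => (n i : ℂ)) = 0 := by
      intro n hn
      have h := (hTiff y).1 hy _ ((memNQ n).1 hn)
      rw [hηcup, LinearEquiv.apply_symm_apply] at h
      exact hsmul0 h
    have hz0 := cxEnd_projection_eq_zero hdisj hzN
    have h := iota_lam_of_proj_eq_zero (T := T) (hc := hc) hz0
    rw [← h]
    exact iota_mem_span T _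
  -- `ψ` as a rational endomorphism `φ` of `Λ_ℚ`, preserving `T`, an element `t` of `E`
  obtain ⟨φ, hφM, hφx, hφ11⟩ := anchorExistence_cmFloor_exists_ratEnd hHT hS η p hp₀ hηint hηcup x hx20
    hx20' hxne ψ hψrat hψtyp
  have hψapp : ∀ y, ψ y = η.symm (cxEnd φ (η y)) := fun y => by
    have h := LinearMap.congr_fun hφM (η y)
    rw [LinearMap.comp_apply, LinearMap.comp_apply, LinearEquiv.coe_coe, LinearEquiv.coe_coe,
      LinearEquiv.symm_apply_apply] at h
    rw [h, LinearEquiv.symm_apply_apply]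
  have hφT : ∀ t ∈ T, φ t ∈ T := fun t ht => map_mem_T hN φ hφx ht
  have htmem : φ.restrict hφT ∈ H.endAlg := restrict_mem_endAlg hN hdisj hxx hxpos φ hφT hφx hφ11
  set t : H.endAlg := ⟨φ.restrict hφT, htmem⟩ with htdef
  -- `φ² = 2` on `T`
  have hφsq : ∀ u ∈ T, φ (φ u) = (2 : ℚ) • u := by
    intro u hu
    have hy := hmemT_of_T u hu
    have h := hψsq _ hy
    have e1 : ψ (η.symm (fun i => (u i : ℂ))) = η.symm (fun i => (φ u i : ℂ)) := by
      rw [hψapp, LinearEquiv.apply_symm_apply, cxEnd_ratCast]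
    have e2 : ψ (η.symm (fun i => (φ u i : ℂ))) = η.symm (fun i => (φ (φ u) i : ℂ)) := by
      rw [hψapp, LinearEquiv.apply_symm_apply, cxEnd_ratCast]
    rw [e1, e2] at h
    have h2 := congrArg η h
    rw [LinearEquiv.apply_symm_apply, map_smul, LinearEquiv.apply_symm_apply] at h2
    apply ratCastΛ_injective
    rw [h2, ratCastΛ_smul, Rat.cast_ofNat]
  have htsq : t * t = algebraMap ℚ H.endAlg 2 := by
    apply Subtype.ext
    apply LinearMap.ext
    intro u
    apply Subtype.ext
    change ((φ.restrict hφT) ((φ.restrict hφT) u) : K3Index → ℚ) =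
      ((algebraMap ℚ (Module.End ℚ T) 2) u : K3Index → ℚ)
    rw [Module.algebraMap_end_apply, LinearMap.restrict_apply, LinearMap.restrict_apply, Submodule.coe_smul]
    exact hφsq u u.2
  -- the dichotomy: CM or totally real
  by_cases hreal : ∀ (φ' : H.endAlg →+* ℂ) (a : H.endAlg), starRingEnd ℂ (φ' a) = φ' a
  · -- totally real: `E = ℚ + ℚ t`
    left
    have hspanE : ∀ e : H.endAlg, ∃ a b : ℚ, e = algebraMap ℚ H.endAlg a + b • t :=
      exists_eq_algebraMap_add_smul_of_mul_self_eq_two hirr hK3 pol hFld hreal (hdimT.trans (by norm_num)) t htsq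
    refine ⟨fun y hy ↦ ?_, fun y _ hyQ ↦ hψrat y hyQ, fun i j y _ hyt ↦ hψtyp i j y hyt, hψsq, hψmul,
      fun f hfrat hftyp hfN hfT ↦ ?_⟩
    · -- `ψ` preserves `T(S)`: `η y ∈ T ⊗ ℂ` and `φ T ⊆ T`
      have key : ∀ z ∈ Submodule.span ℂ (Set.range fun t : T => fun i => ((t : K3Index → ℚ) i : ℂ)),
          η.symm (cxEnd φ z) ∈ transcendentalSubspace S := by
        intro z hz
        induction hz using Submodule.span_induction with
        | mem z hz =>
          obtain ⟨u, rfl⟩ := hz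
          rw [cxEnd_ratCast]
          exact hmemT_of_T _ (hφT u u.2)
        | zero => rw [map_zero, map_zero]; exact Submodule.zero_mem _
        | add a b _ _ ha hb => rw [map_add, map_add]; exact Submodule.add_mem _ ha hb
        | smul c a _ ha => rw [map_smul, map_smul]; exact Submodule.smul_mem _ _ ha
      change ψ y ∈ transcendentalSubspace S
      rw [hψapp]
      exact key _ (hspanT y hy)
    · -- the sector clause: `f|_T ∈ E = ℚ + ℚ t`
      obtain ⟨φf, hφfM, hφfx, hφf11⟩ := anchorExistence_cmFloor_exists_ratEnd hHT hS η p hp₀ hηint hηcup x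
        hx20 hx20' hxne f hfrat hftyp
      have hfapp : ∀ y, f y = η.symm (cxEnd φf (η y)) := fun y => by
        have h := LinearMap.congr_fun hφfM (η y)
        rw [LinearMap.comp_apply, LinearMap.comp_apply, LinearEquiv.coe_coe, LinearEquiv.coe_coe,
          LinearEquiv.symm_apply_apply] at h
        rw [h, LinearEquiv.symm_apply_apply]
      have hφfT : ∀ t ∈ T, φf t ∈ T := fun t ht => map_mem_T hN φf hφfx ht
      have hfmem : φf.restrict hφfT ∈ H.endAlg := restrict_mem_endAlg hN hdisj hxx hxpos φf hφfT hφfx hφf11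
      obtain ⟨a, b, hab⟩ := hspanE ⟨φf.restrict hφfT, hfmem⟩
      -- `φf u = a u + b φ u` on `T`
      have hφfu : ∀ u ∈ T, φf u = a • u + b • φ u := by
        intro u hu
        have h := congrArg (fun e : H.endAlg => (((e : Module.End ℚ T) ⟨u, hu⟩ : T) : K3Index → ℚ)) hab
        simp only [Subalgebra.coe_add, Subalgebra.coe_algebraMap, Subalgebra.coe_smul, LinearMap.add_apply,
          LinearMap.smul_apply, Module.algebraMap_end_apply, Submodule.coe_add, Submodule.coe_smul] at h
        exact h
      refine ⟨a, b, fun y hy ↦ ?_⟩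
      have hyT : y ∈ transcendentalSubspace S := (hTiff y).2 hy
      have hz := hspanT y hyT
      rw [hfapp, hψapp]
      -- linear in `η y ∈ T ⊗ ℂ`
      have key : ∀ z ∈ Submodule.span ℂ (Set.range fun t : T => fun i => ((t : K3Index → ℚ) i : ℂ)),
          cxEnd φf z = (a : ℂ) • z + (b : ℂ) • cxEnd φ z := by
        intro z hz
        induction hz using Submodule.span_induction with
        | mem z hz =>
          obtain ⟨u, rfl⟩ := hz
          rw [cxEnd_ratCast, cxEnd_ratCast, hφfu u u.2, ratCastΛ_add, ratCastΛ_smul, ratCastΛ_smul]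
        | zero => rw [map_zero, map_zero, smul_zero, smul_zero, add_zero]
        | add z w _ _ hz hw => rw [map_add, map_add, hz, hw, smul_add, smul_add]; abel
        | smul c z _ hz => rw [map_smul, map_smul, hz, smul_add, smul_comm c (a : ℂ), smul_comm c (b : ℂ)]
      rw [key _ hz, map_add, map_smul, map_smul, LinearEquiv.symm_apply_apply]
  · -- CM: an element of `End_Hdg(T)` with a non-real eigenvalue on `ω`, extended by `id_N`
    right
    push Not at hreal
    obtain ⟨φ', a, hφ'a⟩ := hreal
    obtain ⟨hadjex, hadjconj⟩ := Zarhin1983_adjoint_eq_conj_holds H hirr hK3 pol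
    obtain ⟨a', ha'⟩ := hadjex a
    have hne : a' ≠ a := by
      intro h
      apply hφ'a
      have key := hadjconj a a' ha' φ'
      rw [h] at key
      exact key.symm
    set μ : ℂ := ε a with hμdef
    have hμ : μ.im ≠ 0 := by
      intro him
      apply hne
      apply hεinj
      have key := hadjconj a a' ha' ε.toRingHom
      change ε a' = starRingEnd ℂ (ε a) at key
      rw [key, ← hμdef]
      exact Complex.conj_eq_iff_im.2 him
    have hamem : ((a : H.endAlg) : Module.End ℚ ↥(k3FormRat.orthogonal NQ)) ∈ H.endAlg := a.2
    set û : Module.End ℚ (K3Index → ℚ) := extendT hdisj (a : Module.End ℚ ↥(k3FormRat.orthogonal NQ)) with hû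
    have hω : omega x hdisj ∈ H.piece 2 0 := (mem_piece_two_zero_ofPeriod _ _).2 ⟨1, one_smul _ _⟩
    have hûx : cxEnd û x = μ • x := by
      have h := hε a (omega x hdisj) hω
      have h2 := congrArg (iota (k3FormRat.orthogonal NQ)) h
      rw [iota_baseChange hdisj, iota_omega hN hdisj, map_smul, iota_omega hN hdisj] at h2
      exact h2
    have hû11 : ∀ z : K3Index → ℂ, k3Form z x = 0 → k3Form z (star x) = 0 →
        k3Form (cxEnd û z) x = 0 ∧ k3Form (cxEnd û z) (star x) = 0 :=
      fun z hzx hzx' => k3Form_cxEnd_extendT hN hdisj hxx hxpos hamem hzx hzx'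
    let Ψ : complexBetti S (2 * 1) →ₗ[ℂ] complexBetti S (2 * 1) :=
      η.symm.toLinearMap ∘ₗ cxEnd û ∘ₗ η.toLinearMap
    have hΨapp : ∀ y, Ψ y = η.symm (cxEnd û (η y)) := fun y => rfl
    have hΨrat : ∀ y, IsRationalClass y → IsRationalClass (Ψ y) := by
      intro y hy
      obtain ⟨w, hw⟩ := (hrat y).1 hy
      rw [hΨapp, hw, cxEnd_ratCast]
      exact (hrat _).2 ⟨û w, LinearEquiv.apply_symm_apply _ _⟩
    have hΨσ : Ψ σ = μ • σ := by rw [hΨapp, hησ, hûx, map_smul]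
    have hΨtyp : ∀ (i j : ℕ) y, IsOfHodgeType 2 S (2 * 1) i j y → IsOfHodgeType 2 S (2 * 1) i j (Ψ y) := by
      refine typePreserving_of_lines hHT hS hx20 hxne Ψ ⟨μ, hΨσ⟩ ⟨star μ, ?_⟩ fun v hv => ?_
      · rw [hσbar, hΨapp, LinearEquiv.apply_symm_apply, cxEnd_star, hûx, star_smul, map_smul]
      · have hv' := hv
        rw [← LinearEquiv.symm_apply_apply η v, h11_iff] at hv'
        rw [hΨapp, h11_iff]
        exact hû11 (η v) hv'.1 hv'.2
    exact ⟨Ψ, hΨrat, hΨtyp, σ, μ, hx20, hxne, hμ, hΨσ⟩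

end Summit.HodgeConjecture.HodgeConjecture.Theorems.MarkmanPartnerTransport.NikulinIsogeny

end
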